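import Literature.AnabelianGeometry.EtaleTheta.SettingModelThetaEigenStatements
import Literature.AnabelianGeometry.EtaleTheta.SettingModelCyclotomicCharacterInvariants
import Literature.AnabelianGeometry.EtaleTheta.SettingModelChiShearInner
import Literature.AnabelianGeometry.EtaleTheta.SettingModelTateInversion
import Literature.AnabelianGeometry.EtaleTheta.SettingModel2InversionCoverings
import Literature.AnabelianGeometry.AbsoluteAnabelian.AbsTopII.DehnTwistFixedSubgroup
import Literature.AnabelianGeometry.AbsoluteAnabelian.AbsTopII.DehnTwistFreeGroupInputs
import Literature.AnabelianGeometry.AbsoluteAnabelian.AbsTopII.DehnTwistEdgeTorusCentralizerCases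
import Literature.AnabelianGeometry.EtaleTheta.SettingModelChiTwistedLatticeCoverings
import HarnessLib

/-!
# (L3′) slice 2, file 1/13 — DEFINITIONS: letters `a^s`/`β_s^t`, `Û_l`, `D′_t`, `b`-type, tori, the structures `Residual`/`AxisPinned`/`Original`/`OriginalSlim`, the wreath quotient, fixed words, transversal

Part of the (L3′) slice-2 chain (abc-iut-L6-t19; FILING SHAPE derived from scratch v5 `Slice2TheoremR2ScratchV5.lean`
551b982286441a66 by the edits E1–E4/D1–D3/H1–H2 of FILING-PLAN-SLICE2.md 9643c7e42a42ad24 and the OPTION-L re-cut of §F v1.19gz (W):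
one definitions file + twelve theorem files).  Classical profinite group theory about OUR semi-synthetic `F₂hatT`; the objects and laws
are those of the one-sentence residual of record (cf. [EtTh] §1, §2 for the role they play there — nothing of [EtTh]/[IUTchII]/[IUTchIII]
in print is asserted; no side on [IUTchIII] Cor. 3.12; MORATORIUM (E): no application to `hext_at_iff_exists_f2hatAut_of_eq`).
-/

noncomputable section

open scoped Pointwise

namespace Literature.AnabelianGeometry.EtaleTheta.SettingModel.Slice2

open Literature.AnabelianGeometry.EtaleTheta.SettingModel
open Literature.AnabelianGeometry.EtaleTheta (ZHatLevel.level ZHatLevel.levelChar)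
open Literature.AnabelianGeometry.SemiGraphs (GQp)
open Literature.AnabelianGeometry.AbsoluteAnabelian
open Literature.AnabelianGeometry.AbsoluteAnabelian.AbsTopII
open _root_.Topology

/-! ## §D1 Letters, `a`-powers `a^s`, `b`-lines `β_s^t`, `Ẑ`-multiplication (data of file Letters) -/

/-- `a := η(x₀)`. [cite: MochizukiEtTh2009, §1 p.12] -/
abbrev ea : F₂hatT := eta (FreeGroup.of 0)

/-- `b := η(x₁)`. [cite: MochizukiEtTh2009, §1 p.12] -/
abbrev eb : F₂hatT := eta (FreeGroup.of 1)

/-- `a^s` for `s ∈ Ẑ`. [cite: MochizukiEtTh2009, §1 p.12] -/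
def aPow (s : ZH) : F₂hatT := powHat ea s

/-- The `b`-line element `β_s^t := a^s b^t a^{-s}` (`s, t ∈ Ẑ`). [cite: MochizukiEtTh2009, §1 p.12] -/
def betaPow (s t : ZH) : F₂hatT := aPow s * bPow t * (aPow s)⁻¹

/-- `1 ∈ ℤ ⊂ Ẑ` (multiplicative spelling). [cite: MochizukiEtTh2009, §1 p.12] -/
abbrev zOne : ZH := ZHatLevel.eta 1

/-- **`zmul u : Ẑ → Ẑ`, `t ↦ u·t`** — the ring multiplication of `Ẑ` in the multiplicative spelling
(`ZHatLevel.powEnd` of the level family of `u`). [cite: RibesZalesskii2010, Thm 2.7.1] -/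
def zmul (u : ZH) : ZH →* ZH := ZHatLevel.powEnd (ZHatLevel.LevelFamily.ofZHat u)

/-- `zmul u` is continuous (every endomorphism of `Ẑ` is). [cite: RibesZalesskii2010, Thm 2.7.1] -/
theorem continuous_zmul (u : ZH) : Continuous (zmul u) := ZHatLevel.continuous_monoidHom _

/-- `zmul u` as a continuous hom. [cite: RibesZalesskii2010, Thm 2.7.1] -/
def zmulC (u : ZH) : ZH →ₜ* ZH := { toMonoidHom := zmul u, continuous_toFun := continuous_zmul u }

/-- [cite: RibesZalesskii2010, Thm 2.7.1] -/
@[simp] theorem zmulC_apply (u t : ZH) : zmulC u t = zmul u t := rfl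

/-- The inversion hom `t ↦ t⁻¹` of the commutative `Ẑ`, as a continuous hom. [cite: RibesZalesskii2010, Thm 2.7.1] -/
def zhInv : ZH →ₜ* ZH :=
  { toMonoidHom := { toFun := fun t : ZH => t⁻¹, map_one' := inv_one,
                     map_mul' := fun a b => by rw [mul_inv_rev, ZHatCompletion.mul_comm] }
    continuous_toFun := continuous_inv }

/-- [cite: RibesZalesskii2010, Thm 2.7.1] -/
@[simp] theorem zhInv_apply (t : ZH) : zhInv t = t⁻¹ := rfl

/-! ## §D2 The open subgroup `Û_l`, the unipotent operators `D′_t`, `b`-type elements, the torus `U^{(l)}` (data of file Uhat) -/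

/-- **`Û_l`**: the elements of `F̂₂` whose level-`l` Heisenberg image has `x = 0` and `z = 0` — degree `≡ 0` and
`z`-coordinate `≡ 0 (mod l)`; a subgroup since the cross term `x₁·y₂` dies once `x₁ = 0` (cf. `dUU`).
[cite: MochizukiEtTh2009, Def 2.5 (i) p.39] -/
def Uhat (l : ℕ+) : Subgroup F₂hatT where
  carrier := {x | (hHat l x).x = 0 ∧ (hHat l x).z = 0}
  one_mem' := ⟨by simp, by simp⟩
  mul_mem' := by
    rintro u v ⟨hux, huz⟩ ⟨hvx, hvz⟩
    exact ⟨by simp only [map_mul, Heis.mul_x, hux, hvx, add_zero],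
      by simp only [map_mul, Heis.mul_z, huz, hvz, hux, zero_mul, add_zero]⟩
  inv_mem' := by
    rintro u ⟨hux, huz⟩
    exact ⟨by simp only [map_inv, Heis.inv_x, hux, neg_zero],
      by simp only [map_inv, Heis.inv_z, huz, hux, neg_zero, zero_mul, add_zero]⟩

/-- **`D′_t := Inn(b^t) ∘ s_{2t}`** (`a ↦ b^t a b^{2t} b^{-t} = b^t a b^t`, `b ↦ b`): the `(1,2)`-asymmetric unipotent
operator of `modelTate (p,1,2)` restricted to `F̂₂` (PL3-R2 S0). [cite: MochizukiEtTh2009, Prop 1.5 (iii) p.23] -/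
def Dp (t : ZH) : F₂hatT ≃ₜ* F₂hatT := (shear (t * t)).trans (innB t)

/-- **`b`-type elements**: `C := ⋃_g g b^Ẑ g⁻¹`. [cite: MochizukiEtTh2009, §1 p.12] -/
def IsBType (x : F₂hatT) : Prop := ∃ g : F₂hatT, ∃ u : ZH, x = g * bPow u * g⁻¹

section Torus

variable (p : ℕ) [Fact p.Prime]

/-- **`U^{(l)} := {σ | χ(σ) ≡ 1 (mod l)}`**, the level-`l` congruence torus in `G_{ℚ_p}`. [cite: MochizukiEtTh2009, §1 p.12] -/
def torusCong (l : ℕ+) : Subgroup (GQp p) where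
  carrier := {σ | ZHatLevel.levelChar l (chi p σ) = 1}
  one_mem' := by simp
  mul_mem' := by
    intro σ τ hσ hτ
    simp only [Set.mem_setOf_eq, map_mul] at *
    rw [hσ, hτ, mul_one]
  inv_mem' := by
    intro σ hσ
    simp only [Set.mem_setOf_eq, map_inv] at *
    have h := ZHatLevel.levelChar_mul_levelChar_inv l (chi p σ)
    rw [hσ, one_mul] at h
    exact h

end Torus

/-! ## §D3 THE RESIDUAL HYPOTHESES (PL3-R2 S0) as a `Prop`-valued structure; `Ψ′|_{Û_l}` as a homomorphism (data of file Residual) -/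

section Residual

variable (p : ℕ) [Fact p.Prime]

/-- **The ONE-SENTENCE RESIDUAL OF RECORD** (PL3-R1A §2.5 / PL3-R2 S0), as hypotheses on a bare map
`Ψ : F̂₂ → F̂₂` whose restriction to `Û_l` is the object of interest:
`Ψ′ : Û_l → Û′_l := f′⁻¹ Û_l f′` a continuous injective hom (hom, continuous, injective on `Û_l`, INTO `Û′_l`);
(θ) `Ψ′ θ_{χσ} = θ_{χσ} Ψ′` for `σ` in a finite-index torus `U₀ ≤ G_{ℚ_p}`; (C) `Ψ′(Û∩C) = Û′∩C`;
(B) `Ψ′(Û∩B) = Û′∩B`; (D′) `Ψ′ ∘ D′_t = Inn(e_t) ∘ D′_t ∘ Ψ′` on `Û_l` with `e_t ∈ F̂₂` (B-valuedness is then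
a COROLLARY of (B), `Residual.dlaw_bAxis`), for every `t ∈ M := mẐ` (`l ∣ m`; `t = k^m` in the multiplicative
spelling of `Ẑ`).  A `Prop`-valued structure about OUR objects; nothing of
[EtTh] is asserted.  AUDIT PRECISION P1 (f-193 g27, kernel-certified by ProbeNoSurj 8a719dcea7e9891a; lead §F v1.19gz
(S) (v3-b)): the record's «onto `Û′_l`» is DROPPED here — a free strengthening: Theorem R2 holds for an injective
continuous hom `Û_l → F̂₂` with `Ψ′(Û_l) ⊆ f′⁻¹ Û_l f′`, and `Û′ = Û` then FOLLOWS (`AxisPinned.normal`);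
`Original.surj` IS load-bearing and stays. [cite: MochizukiEtTh2009, §1 p.12] -/
structure Residual (l : ℕ+) (U₀ : Subgroup (GQp p)) (m : ℕ+) (f' : F₂hatT) (Ψ : F₂hatT → F₂hatT) : Prop where
  /-- `l ∣ m` (so that every `D′_t`, `t ∈ mẐ`, preserves `Û_l`). -/
  dvd : (l : ℕ) ∣ m
  /-- `Ψ′` is multiplicative on `Û_l`. -/
  mul : ∀ x ∈ Uhat l, ∀ y ∈ Uhat l, Ψ (x * y) = Ψ x * Ψ y
  /-- `Ψ′|_{Û_l}` is continuous. -/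
  cont : Continuous fun x : Uhat l => Ψ x
  /-- `Ψ′` is injective on `Û_l`. -/
  inj : ∀ x ∈ Uhat l, ∀ y ∈ Uhat l, Ψ x = Ψ y → x = y
  /-- `Ψ′(Û_l) ⊆ f′⁻¹ Û_l f′`. -/
  mapsTo : ∀ x ∈ Uhat l, f' * Ψ x * f'⁻¹ ∈ Uhat l
  /-- (θ): exact torus equivariance on `U₀`. -/
  torus : ∀ σ ∈ U₀, ∀ x ∈ Uhat l, Ψ (twist (chi p σ) x) = twist (chi p σ) (Ψ x)
  /-- (C): `b`-type elements of `Û_l` correspond under `Ψ′`. -/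
  btype : ∀ x ∈ Uhat l, IsBType x ↔ IsBType (Ψ x)
  /-- (B): `Ψ′(Û ∩ B) = Û′ ∩ B`. -/
  axis : ∀ x ∈ Uhat l, x ∈ bAxis ↔ Ψ x ∈ bAxis
  /-- (D′): `Ψ′ ∘ D′_t = Inn(e_t) ∘ D′_t ∘ Ψ′` on `Û_l` for every `t = k^m ∈ mẐ`, with SOME cocycle value
  `e_t ∈ F̂₂` (that `e_t ∈ B` is DERIVED from (B): `Residual.dlaw_bAxis` — R1A Prop R1b (3), coarse half). -/
  dlaw : ∀ k : ZH, ∃ e : F₂hatT, ∀ x ∈ Uhat l, Ψ (Dp (k ^ (m : ℕ)) x) = e * Dp (k ^ (m : ℕ)) (Ψ x) * e⁻¹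

variable {p} {l : ℕ+} {U₀ : Subgroup (GQp p)} {m : ℕ+} {f' : F₂hatT} {Ψ : F₂hatT → F₂hatT}

namespace Residual

/-- `Ψ′ 1 = 1`. [cite: MochizukiEtTh2009, §1 p.12] -/
theorem psi_one (h : Residual p l U₀ m f' Ψ) : Ψ 1 = 1 := by
  have := h.mul 1 (one_mem _) 1 (one_mem _)
  rw [one_mul] at this
  exact left_eq_mul.mp this

/-- `Ψ′ x⁻¹ = (Ψ′ x)⁻¹` on `Û_l`. [cite: MochizukiEtTh2009, §1 p.12] -/
theorem psi_inv (h : Residual p l U₀ m f' Ψ) {x : F₂hatT} (hx : x ∈ Uhat l) : Ψ x⁻¹ = (Ψ x)⁻¹ := by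
  have := h.mul x⁻¹ (inv_mem hx) x hx
  rw [inv_mul_cancel, h.psi_one] at this
  exact eq_inv_of_mul_eq_one_left this.symm

/-- The restriction `Ψ′|_{Û_l}` as a monoid hom `Û_l →* F̂₂`. [cite: MochizukiEtTh2009, §1 p.12] -/
def hom (h : Residual p l U₀ m f' Ψ) : Uhat l →* F₂hatT where
  toFun x := Ψ x
  map_one' := h.psi_one
  map_mul' x y := h.mul x x.2 y y.2

/-- [cite: MochizukiEtTh2009, §1 p.12] -/
@[simp] theorem hom_apply (h : Residual p l U₀ m f' Ψ) (x : Uhat l) : h.hom x = Ψ x := rfl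

end Residual

end Residual

/-! ## §D4 The splitting elements `d_{s,t}` (data of file Axis; `Residual.line` stays in Axis — it is chosen from a theorem) -/

/-- **`d_{s,t} := b^t · (a b^{2t})^s · a^{-s}`** — the element by which `D′_t` acts on `P_s = a^s Π_v a^{-s}`
(PL3-R2 S6: `D′_t = Inn(d_{s,t}) ∘ s^{(s)}_{2t}`). [cite: MochizukiEtTh2009, Prop 1.5 (iii) p.23] -/
def dElt (s t : ZH) : F₂hatT := bPow t * powHat (ea * bPow (t * t)) s * (aPow s)⁻¹

/-! ## §D5 The wreath quotient `F̂₂ → (ℤ/N)^{ℤ/4} ⋊ ℤ/4` (data of file Wreath) -/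

section Wreath

open SemidirectProduct

variable (N : ℕ+)

/-- The base of the wreath quotient: functions `ℤ/4 → ℤ/N` (multiplicative spelling). [cite: MochizukiEtTh2009, §1 p.12] -/
abbrev WB : Type := ZMod 4 → Multiplicative (ZMod N)

/-- Shift of functions by `c ∈ ℤ/4`: `(c · f)(z) = f(z − c)`. [cite: MochizukiEtTh2009, §1 p.12] -/
def wShiftEquiv (c : ZMod 4) : WB N ≃* WB N where
  toFun f := fun z => f (z - c)
  invFun f := fun z => f (z + c)
  left_inv f := by funext z; simp
  right_inv f := by funext z; simp
  map_mul' f g := rfl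

/-- [cite: MochizukiEtTh2009, §1 p.12] -/
@[simp] theorem wShiftEquiv_apply (c : ZMod 4) (f : WB N) (z : ZMod 4) : wShiftEquiv N c f z = f (z - c) := rfl

/-- The shift action `ℤ/4 → Aut((ℤ/N)^{ℤ/4})`. [cite: MochizukiEtTh2009, §1 p.12] -/
def wShift : Multiplicative (ZMod 4) →* MulAut (WB N) where
  toFun c := wShiftEquiv N (Multiplicative.toAdd c)
  map_one' := by ext f z; simp
  map_mul' c c' := by
    ext f z
    simp only [toAdd_mul, MulAut.mul_apply, wShiftEquiv_apply]
    congr 1; ring_nf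

/-- [cite: MochizukiEtTh2009, §1 p.12] -/
@[simp] theorem wShift_apply (c : Multiplicative (ZMod 4)) (f : WB N) (z : ZMod 4) :
    wShift N c f z = f (z - Multiplicative.toAdd c) := rfl

/-- The wreath quotient `W_N := (ℤ/N)^{ℤ/4} ⋊ ℤ/4`. [cite: MochizukiEtTh2009, §1 p.12] -/
abbrev WG : Type := WB N ⋊[wShift N] Multiplicative (ZMod 4)

/-- The base element `δ_c^v` (value `v` at residue `c`, `0` elsewhere). [cite: MochizukiEtTh2009, §1 p.12] -/
def wDelta (c : ZMod 4) (v : ZMod N) : WB N := fun z => if z = c then Multiplicative.ofAdd v else 1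

/-- [cite: MochizukiEtTh2009, §1 p.12] -/
@[simp] theorem wDelta_apply (c : ZMod 4) (v : ZMod N) (z : ZMod 4) :
    wDelta N c v z = if z = c then Multiplicative.ofAdd v else 1 := rfl

/-- `ω : F₂ → W_N`, `a ↦ (0, 1)` (shift), `b ↦ (δ_0^1, 0)`. [cite: MochizukiEtTh2009, §1 p.12] -/
def omegaW : F₂ →* WG N := FreeGroup.lift ![inr (Multiplicative.ofAdd 1), inl (wDelta N 0 1)]

/-- `W_N` is finite. [cite: MochizukiEtTh2009, §1 p.12] -/
theorem finite_WG : Finite (WG N) := Finite.of_equiv _ (SemidirectProduct.equivProd).symm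

/-- The kernel of `ω` as a finite-index normal subgroup of `F₂`. [cite: MochizukiEtTh2009, §1 p.12] -/
def KW : FiniteIndexNormalSubgroup F₂ :=
  haveI : Finite (WG N) := finite_WG N
  FiniteIndexNormalSubgroup.ofSubgroup (omegaW N).ker

/-- [cite: MochizukiEtTh2009, §1 p.12] -/
theorem KW_toSubgroup : (KW N).toSubgroup = (omegaW N).ker := rfl

/-- **`ω̂ : F̂₂ → W_N`**, the extension of `ω` through the `Ker ω`-component of the completion.
[cite: MochizukiEtTh2009, §1 p.12] -/
def omegaHat : F₂hatT →* WG N :=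
  (QuotientGroup.kerLift (omegaW N)).comp (MonoidHom.mk' (fun x : F₂hatT => x.val (KW N)) (fun _ _ => rfl))

/-- `ω̂(η g) = ω(g)`. [cite: MochizukiEtTh2009, §1 p.12] -/
theorem omegaHat_eta (g : F₂) : omegaHat N (eta g) = omegaW N g := rfl

/-- `cnt4 D z = #{j ∈ [1, D] : j ≡ z (mod 4)}`. [cite: MochizukiEtTh2009, §1 p.12] -/
def cnt4 : ℕ → ZMod 4 → ℕ
  | 0, _ => 0
  | D + 1, z => cnt4 D z + if ((D + 1 : ℕ) : ZMod 4) = z then 1 else 0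

end Wreath

/-! ## §D6 THE PINNED AXIS as a `Prop`-valued structure (data of file Pinned) -/

/-- **(S1–S5 OUTPUT) THE PINNED AXIS** — what the rest of the proof of Theorem R2 consumes, in the normalised
case `ε = 1`: the unipotent law holds ON THE NOSE, `Ψ′` fixes every `d_{i,t}` (`i ∈ ℤ`, `t ∈ mẐ`), every
axis cusp `β_i^u ∈ Û_l`, every `b^u`, and `A = a^l`; and `f′` normalises `Û_l` (`Û′ = Û`).
[cite: MochizukiEtTh2009, §1 p.12] -/
structure AxisPinned (p : ℕ) [Fact p.Prime] (l : ℕ+) (U₀ : Subgroup (GQp p)) (m : ℕ+) (f' : F₂hatT)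
    (Ψ : F₂hatT → F₂hatT) : Prop where
  /-- the residual hypotheses -/
  res : Residual p l U₀ m f' Ψ
  /-- (D′) on the nose -/
  dexact : ∀ k : ZH, ∀ x ∈ Uhat l, Ψ (Dp (k ^ (m : ℕ)) x) = Dp (k ^ (m : ℕ)) (Ψ x)
  /-- `Ψ′(d_{i,t}) = d_{i,t}` -/
  dElt_fixed : ∀ k : ZH, ∀ i : ℤ, Ψ (dElt (ZHatLevel.eta i) (k ^ (m : ℕ))) = dElt (ZHatLevel.eta i) (k ^ (m : ℕ))
  /-- `Ψ′` is the identity on every axis cusp group `Û ∩ a^i B a^{-i}` -/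
  cusp_fixed : ∀ i : ℤ, ∀ u : ZH, betaPow (ZHatLevel.eta i) u ∈ Uhat l → Ψ (betaPow (ZHatLevel.eta i) u) = betaPow (ZHatLevel.eta i) u
  /-- `Ψ′(b^u) = b^u` -/
  bPow_fixed : ∀ u : ZH, Ψ (bPow u) = bPow u
  /-- `Ψ′(A) = A` -/
  A_fixed : Ψ (aPow (ZHatLevel.eta (l : ℤ))) = aPow (ZHatLevel.eta (l : ℤ))
  /-- `Û′ = Û`: `f′` normalises `Û_l` -/
  normal : ∀ y : F₂hatT, f' * y * f'⁻¹ ∈ Uhat l ↔ y ∈ Uhat l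

/-! ## §D7 The torus `U‴ := U₀ ∩ U^{(l)}` (data of file Cusps) -/

/-- The torus `U‴ := U₀ ∩ U^{(l)}` (finite index). [cite: MochizukiEtTh2009, §1 p.12] -/
abbrev U3 (p : ℕ) [Fact p.Prime] (l : ℕ+) (U₀ : Subgroup (GQp p)) : Subgroup (GQp p) := U₀ ⊓ torusCong p l

/-! ## §D8 `Û ∩ F₂`, the fixed words, the letters `ξ`, `ξ′`, `u_{x,s}` (data of file Parallel) -/

section ParallelData

variable {p : ℕ} [Fact p.Prime] {l : ℕ+} {U₀ : Subgroup (GQp p)} {m : ℕ+} {f' : F₂hatT} {Ψ : F₂hatT → F₂hatT}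

/-- The discrete shadow `U_d := η⁻¹(Û_l) ≤ F₂`. [cite: MochizukiEtTh2009, Def 2.5 (i) p.39] -/
def Ud (l : ℕ+) : Subgroup F₂ := (Uhat l).comap eta

/-- The words whose `η`-image is `Ψ′`-fixed (a subgroup of `U_d`, `Ψ′` being a hom on `Û_l`).
[cite: MochizukiEtTh2009, §1 p.12] -/
def Residual.fixedWords (h : Residual p l U₀ m f' Ψ) : Subgroup F₂ where
  carrier := {g | eta g ∈ Uhat l ∧ Ψ (eta g) = eta g}
  one_mem' := ⟨by rw [map_one]; exact one_mem _, by rw [map_one, h.psi_one]⟩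
  mul_mem' := by
    rintro g g' ⟨hg, hψg⟩ ⟨hg', hψg'⟩
    refine ⟨by rw [map_mul]; exact mul_mem hg hg', ?_⟩
    rw [map_mul, h.mul _ hg _ hg', hψg, hψg']
  inv_mem' := by
    rintro g ⟨hg, hψg⟩
    refine ⟨by rw [map_inv]; exact inv_mem hg, ?_⟩
    rw [map_inv, h.psi_inv hg, hψg]

/-- The parallel cusp `ξ_{x,s}^{(v)} := β_{x−1}^s β_x^v β_{x−1}^{-s}` (vertex `x−1`). [cite: MochizukiEtTh2009, §1 p.12] -/
def xiC (x : ℤ) (s v : ZH) : F₂hatT :=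
  betaPow (ZHatLevel.eta (x - 1)) s * betaPow (ZHatLevel.eta x) v * (betaPow (ZHatLevel.eta (x - 1)) s)⁻¹

/-- The parallel cusp `ξ′_{x,s}^{(v)} := β_{x+1}^{-s} β_x^v β_{x+1}^{s}` (vertex `x`). [cite: MochizukiEtTh2009, §1 p.12] -/
def xiC' (x : ℤ) (s v : ZH) : F₂hatT :=
  betaPow (ZHatLevel.eta (x + 1)) s⁻¹ * betaPow (ZHatLevel.eta x) v * (betaPow (ZHatLevel.eta (x + 1)) s⁻¹)⁻¹

/-- The stable letter `u_{x,s} := β_{x−1}^s β_x^{−2s} β_{x+1}^s`. [cite: MochizukiEtTh2009, §1 p.12] -/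
def uElt (x : ℤ) (s : ZH) : F₂hatT :=
  betaPow (ZHatLevel.eta (x - 1)) s * betaPow (ZHatLevel.eta x) (s⁻¹ * s⁻¹) * betaPow (ZHatLevel.eta (x + 1)) s

end ParallelData

/-! ## §D9 THE ORIGINAL LAWS (torus law with a cocycle) and their SLIM form; inner automorphisms as topological equivalences (data of file Original; `Original.lineMap` stays in Original — it is chosen from a theorem) -/

/-- **THE ORIGINAL (L3′) HYPOTHESES** (PL3-DESK §1 / PL3-R1A §2.4 SETTING, in OUR vocabulary): `Ψ` a bi-continuous
automorphism of `Û_l`; TORUS LAW `Ψ θ_{χσ} = Inn(η_σ) θ_{χσ} Ψ` on `Û_l` for `σ` in a finite-index `U₀`, with `η`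
a `θ`-cocycle on `U₀`; UNIPOTENT LAW `Ψ D′_t = Inn(e_t) D′_t Ψ` on `Û_l`, `t ∈ mẐ` (`l ∣ m`); `C`-PRESERVATION.
[cite: MochizukiEtTh2009, §1 p.12] -/
structure Original (p : ℕ) [Fact p.Prime] (l : ℕ+) (U₀ : Subgroup (GQp p)) (m : ℕ+) (Ψ : F₂hatT → F₂hatT) : Prop where
  dvd : (l : ℕ) ∣ m
  mul : ∀ x ∈ Uhat l, ∀ y ∈ Uhat l, Ψ (x * y) = Ψ x * Ψ y
  cont : Continuous fun x : Uhat l => Ψ x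
  inj : ∀ x ∈ Uhat l, ∀ y ∈ Uhat l, Ψ x = Ψ y → x = y
  mapsTo : ∀ x ∈ Uhat l, Ψ x ∈ Uhat l
  surj : ∀ y ∈ Uhat l, ∃ x ∈ Uhat l, Ψ x = y
  torus : ∃ η : GQp p → F₂hatT, (∀ u ∈ U₀, ∀ v ∈ U₀, η (u * v) = η u * twist (chi p u) (η v)) ∧
    ∀ σ ∈ U₀, ∀ x ∈ Uhat l, Ψ (twist (chi p σ) x) = η σ * twist (chi p σ) (Ψ x) * (η σ)⁻¹
  btype : ∀ x ∈ Uhat l, IsBType x ↔ IsBType (Ψ x)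
  dlaw : ∀ k : ZH, ∃ e : F₂hatT, ∀ x ∈ Uhat l, Ψ (Dp (k ^ (m : ℕ)) x) = e * Dp (k ^ (m : ℕ)) (Ψ x) * e⁻¹

/-- **The ORIGINAL hypotheses, slim form**: as `Original` but the torus law only posits conjugating elements
`η_σ` — NO cocycle identity (it is derived, `OriginalSlim.toOriginal`). [cite: MochizukiEtTh2009, §1 p.12] -/
structure OriginalSlim (p : ℕ) [Fact p.Prime] (l : ℕ+) (U₀ : Subgroup (GQp p)) (m : ℕ+) (Ψ : F₂hatT → F₂hatT) :
    Prop where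
  /-- `l ∣ m` -/
  dvd : (l : ℕ) ∣ m
  /-- `Ψ` is multiplicative on `Û_l` -/
  mul : ∀ x ∈ Uhat l, ∀ y ∈ Uhat l, Ψ (x * y) = Ψ x * Ψ y
  /-- `Ψ|_{Û_l}` is continuous -/
  cont : Continuous fun x : Uhat l => Ψ x
  /-- `Ψ|_{Û_l}` is injective -/
  inj : ∀ x ∈ Uhat l, ∀ y ∈ Uhat l, Ψ x = Ψ y → x = y
  /-- `Ψ(Û_l) ⊆ Û_l` -/
  mapsTo : ∀ x ∈ Uhat l, Ψ x ∈ Uhat l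
  /-- `Ψ(Û_l) ⊇ Û_l` -/
  surj : ∀ y ∈ Uhat l, ∃ x ∈ Uhat l, Ψ x = y
  /-- the torus law: `Ψ θ_σ = Inn(η_σ) θ_σ Ψ` on `Û_l` for `σ ∈ U₀`, SOME `η_σ` -/
  torus : ∃ η : GQp p → F₂hatT, ∀ σ ∈ U₀, ∀ x ∈ Uhat l, Ψ (twist (chi p σ) x) = η σ * twist (chi p σ) (Ψ x) * (η σ)⁻¹
  /-- `C`-preservation -/
  btype : ∀ x ∈ Uhat l, IsBType x ↔ IsBType (Ψ x)
  /-- the unipotent law on `mẐ` with some cocycle -/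
  dlaw : ∀ k : ZH, ∃ e : F₂hatT, ∀ x ∈ Uhat l, Ψ (Dp (k ^ (m : ℕ)) x) = e * Dp (k ^ (m : ℕ)) (Ψ x) * e⁻¹

/-- `Inn(f)` as a topological automorphism of `F̂₂` (the tree's `innB` pattern, any `f`). [cite: MochizukiEtTh2009, §1 p.12] -/
def innEquiv (f : F₂hatT) : F₂hatT ≃ₜ* F₂hatT :=
  { MulAut.conj f with
    continuous_toFun := (continuous_const.mul continuous_id).mul continuous_const
    continuous_invFun := (continuous_const.mul continuous_id).mul continuous_const }

/-! ## §D10 The Schreier representatives and the transversal `T_l` (data of file Transversal) -/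

/-- The representative `β_{x−1}^s a^x b^i` as a word. [cite: MochizukiEtTh2009, §1 p.12] -/
def rep (x s i : ℤ) : F₂ := (FreeGroup.of 0 : F₂) ^ (x - 1) * (FreeGroup.of 1 : F₂) ^ s * (FreeGroup.of 0 : F₂) ^ (1 - x) * ((FreeGroup.of 0 : F₂) ^ x * (FreeGroup.of 1 : F₂) ^ i)

/-- The transversal `T′` (every `l`). [cite: MochizukiEtTh2009, §1 p.12] -/
def transT (l : ℕ+) : Set F₂ :=
  {t | ∃ x s i : ℤ, 0 ≤ x ∧ x ≤ (l : ℤ) - 1 ∧ 0 ≤ s ∧ s < (Int.gcd x l : ℤ) ∧ 0 ≤ i ∧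
    i < (l : ℤ) / (Int.gcd x l : ℤ) ∧ t = rep x s i}

end Literature.AnabelianGeometry.EtaleTheta.SettingModel.Slice2

end
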